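import Summits.ResolutionOfSingularities.ResolutionOfSingularities.Theorems.HilbertSamuelEliminationSigmaMaxModificationsCorridor3WLadderStrataBirthsTopRebirthStep
import Summits.ResolutionOfSingularities.ResolutionOfSingularities.Theorems.HilbertSamuelEliminationSigmaMaxModificationsCorridor3WLadderStrataNearFibre
import HarnessLib

/-!
# [OURS · L1 W4.2] THE CENTRE GERM AT A NEVER-ISOLATED BLOWN-UP CYCLE-END CHAIN POINT: dimension ≥ 1 always, and
# dimension ≥ 2 ⇒ the near fibre over the chain point is a subsingleton (CJS Thm. 3.14, F-61, by name) — the cycle-end centre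
# dichotomy at `ē ≤ 3` REDUCED to its dimension-ONE (curve) case
# (cell res-hironaka, LADDER-RESOLUTION rung L; slot W4.2, crux chain w42 `SigmaMaxModificationsCorridor3`
# stmt-ResolutionOfSingularities-19249; `--supports stmt-ResolutionOfSingularities-19249 --as helper`; hand res-D-brk-3 (gen 5);
# a strategy-agnostic LOCAL brick in the sense of res-L1-w42-plan-1 RULINGS v3.14-8 (CA) — consumed per cycle end)

res-type-067's `CycleEndCentreDichotomy3 p` (p515936; an OURS CLAIM, «cover + confinement», a CONTINUING local law per RULINGS v3.14-8
(CA)) says: at a blown-up cycle-end step of a never-isolated W-top chain EITHER some canonical centre admits a centre-adapted CP frame at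
`x_n` (the centre germ at `x_n` is a regular CURVE) OR the near fibre over `x_n` is a subsingleton (the centre germ is a SURFACE). This file
PROVES the dimension bookkeeping and the surface half, so that the claim — in the regime of the printed Thm. 3.14 (`CharHypothesis`) — is
REDUCED to the existence of adapted frames along CURVE centre germs (W4.2 DEAL D18 (ii), `exists_isCPFrameAlong_of_isHypStage`,
res-D-pv-050). Everything here is PROVED; the only non-kernel input is the NAMED printed fact F-61
`CossartJannsenSaito2020.Thm314_nearFibre_subsingleton` (CJS LNM 2270 Thm. 3.14, near-fibre rendering; typed p514197, c3 YES) taken as a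
hypothesis `(h314f : …)`. OURS bookkeeping (cell res-hironaka, slot W4.2); NOT a statement of Hironaka's manuscript [Hironaka2017] nor of
[CossartJannsenSaito2020]; never a `Theses/…` import; 0 `def`s. AI-written, weaker than expert review.

## What is proved (namespace `…Theorems.SigmaMaxModificationsCorridor3.Moving`)

* `one_le_ringKrullDim_centre_of_cycleEnd` — at a canonical near step leading to a state between cycles (`s'.P = none`: the centre
  is the whole treated part `Y_n^{(j)}`, `support_eq_part_of_next_none`), under the cycle invariant, if the marked point `x_n` lies in the
  centre `C` and is NOT isolated in `X_n(ν)`, then `dim 𝒪_{V(C),x_n} ≥ 1`: the component of `V(C) = Y_n^{(j)}` through `x_n` is a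
  component of `X_n(ν)` (`componentsIn_part_subset`), hence not `{x_n}` (`CycleInv.singleton_notMem_componentsIn_of_not_iso`), so its
  generic point is a non-trivial generisation of `x_n` inside `V(C)` (stub-4's `one_le_ringKrullDim_quotient_stalkIdeal`).
* `nearFibre_subsingleton_of_two_le_dim_centre` — SURFACE HALF: at a step projection with canonical centre `C ∋ x_n`, under the cycle
  invariant, `CharHypothesis X_n x_n`, `ē(x_n) ≤ 3` and `dim 𝒪_{V(C),x_n} ≥ 2`, the points of `X_{n+1}(ν)` over `x_n` form a
  subsingleton: `e ≤ ē ≤ 3 ≤ dim 𝒪_{V(C),x_n} + 1`, so Thm. 3.14 (F-61, by name) applies (stub-4's `StepProjection.nearFibre_subsingleton`).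
* `centreGerm_dim_eq_one_or_nearFibre_subsingleton` — THE REDUCTION: at a blown-up cycle-end step of a never-isolated chain with
  `ē(x_n) ≤ 3` and `CharHypothesis`, EITHER `dim 𝒪_{V(C),x_n} = 1` (curve germ — where an adapted frame is to be produced, D18 (ii)) OR the
  near fibre over `x_n` is a subsingleton.

References: CJS LNM 2270 Thm. 3.14, Def. 3.1, Rem. 6.29 (1) [CossartJannsenSaito2020]; tree p514197 (F-61), `…StrataNearFibre` (stub-4),
`…StrataLabels` (p503069), `…StrataScope` (p504439), p515936; HOME STATUS res-L1-w42-plan-1 09:50:06Z (CA), res-D-pv-050 D18 CUT 09:33:13Z.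
-/

noncomputable section

set_option linter.dupNamespace false

open CategoryTheory AlgebraicGeometry TopologicalSpace Topology Polynomial IsLocalRing
open Summit.ResolutionOfSingularities.ResolutionOfSingularities.Theorems.CampaignW42
open Literature.AlgebraicGeometry.Resolution Literature.RingTheory.HilbertSamuel
open Literature.AlgebraicGeometry.CossartJannsenSaito2020
open Summit.ResolutionOfSingularities.ResolutionOfSingularities.Theorems.SigmaMaxModificationsCorridor3

namespace Summit.ResolutionOfSingularities.ResolutionOfSingularities.Theorems.SigmaMaxModificationsCorridor3.Moving

universe u

variable {R : ∀ S : Scheme.{u}, CentreSeq S → Prop} {ν : ℕ → ℕ}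

/-- [OURS · L1 W4.2] **SURFACE HALF of the cycle-end centre dichotomy: a centre germ of dimension `≥ 2` at `x_n` confines the near
fibre to a point.** At a step projection `f : X_{n+1} → X_n` with canonical centre `C ∋ x_n`, under the cycle invariant (excellent stage of
dimension `≤ 3`, permissible centre), `CharHypothesis X_n x_n`, `ē_{x_n}(X_n) ≤ 3` and `dim 𝒪_{V(C),x_n} ≥ 2`: the points of `X_{n+1}(ν)`
over `x_n` form a subsingleton — `e_{x_n} ≤ ē_{x_n} ≤ 3 ≤ dim 𝒪_{V(C),x_n} + 1` and CJS Thm. 3.14 in the near-fibre rendering (F-61,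
hypothesis `h314f`). [cite: CossartJannsenSaito2020, Thm. 3.14] -/
theorem nearFibre_subsingleton_of_two_le_dim_centre (h314f : Thm314_nearFibre_subsingleton.{u}) {k : Type u} [Field k]
    (hRf : OracleFunctional R) (hRa : OracleAdmissible R) (hν : ν ≠ iterPSum 3 Phi)
    {s s' : MarkedStage.{u}} (h : CycleInv k R 3 ν s) {f : s'.W ⟶ s.W} (hf : StepProjection R 3 ν s s' f)
    {C : s.W.IdealSheafData} {P' : Option (Pending (blowup C))} (hcs : IsCanonicalStep R 3 ν s.L s.P C P')
    (hmem : s.pt ∈ (C.support : Set s.W)) (hchar : CharHypothesis s.W s.pt) (hpt : s.pt ∈ Scheme.hsStratum s.W 3 ν)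
    (hē : s.geomDirDim ≤ 3)
    (hdim : ((2 : ℕ) : WithBot ℕ∞) ≤ ringKrullDim (s.W.presheaf.stalk s.pt ⧸ stalkIdeal C s.pt)) :
    {z : s'.W | f.base z = s.pt ∧ z ∈ Scheme.hsStratum s'.W 3 ν}.Subsingleton := by
  haveI := s.ln
  refine hf.nearFibre_subsingleton h314f hRf hcs h.isExcellent (h.centre hRa hν hcs).2.2.1 h.dim_le hmem hchar hpt ?_
  have h1 : (@Scheme.dirDim s.W s.ln s.pt : WithBot ℕ∞) ≤ (3 : WithBot ℕ∞) := by
    have := (Scheme.dirDim_le_geomDirDim (X := s.W) s.pt).trans hē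
    exact_mod_cast this
  refine h1.trans ?_
  calc (3 : WithBot ℕ∞) = ((2 : ℕ) : WithBot ℕ∞) + 1 := by norm_num
    _ ≤ ringKrullDim (s.W.presheaf.stalk s.pt ⧸ stalkIdeal C s.pt) + 1 := by gcongr


/-- [OURS · L1 W4.2] **The centre germ at a never-isolated blown-up CYCLE-END chain point has dimension `≥ 1`.** At a canonical near
step `X_n ← X_{n+1}` leading to a state between cycles (the centre is the whole treated part `Y_n^{(j)}`), under the cycle invariant,
if `x_n ∈ V(C)` is closed and NOT isolated in `X_n(ν)` then `1 ≤ dim 𝒪_{V(C),x_n}`: the component of `Y_n^{(j)}` through `x_n` is a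
component of `X_n(ν)`, not `{x_n}`, and its generic point generises `x_n` non-trivially inside `V(C)`.
[cite: CossartJannsenSaito2020, Rem. 6.29 (1), Def. 3.1] -/
theorem one_le_ringKrullDim_centre_of_cycleEnd {k : Type u} [Field k] (hRf : OracleFunctional R)
    {s s' : MarkedStage.{u}} (h : CycleInv k R 3 ν s) (hst : CanonicalNearStep R 3 ν s s') (hnone : s'.P = none)
    {C : s.W.IdealSheafData} {P' : Option (Pending (blowup C))} (hcs : IsCanonicalStep R 3 ν s.L s.P C P')
    (hmem : s.pt ∈ (C.support : Set s.W)) (hcl : IsClosed ({s.pt} : Set s.W)) (hpt : s.pt ∈ Scheme.hsStratum s.W 3 ν)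
    (hnI : ¬ Iso 3 s) :
    (1 : WithBot ℕ∞) ≤ ringKrullDim (s.W.presheaf.stalk s.pt ⧸ stalkIdeal C s.pt) := by
  haveI := s.ln
  haveI : IsNoetherian s.W := h.isNoetherian
  -- the component of the centre through `x_n`
  obtain ⟨Z, hZ, hxZ⟩ := componentsIn.exists_mem hmem
  have hsupp : (C.support : Set s.W) = s.L.part (Scheme.hsStratum s.W 3 ν) (treatedLabel 3 ν s) :=
    support_eq_part_of_next_none hRf hst hnone hcs
  have hZY : Z ∈ componentsIn (Scheme.hsStratum s.W 3 ν) := by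
    rw [hsupp] at hZ
    exact componentsIn_part_subset s.L h.isClosed_hsStratum (componentsIn.finite _) _ hZ
  have hZirr : IsIrreducible Z := componentsIn.isIrreducible hZ
  have hZcl : IsClosed Z := componentsIn.isClosed C.support.isClosed hZ
  -- its generic point is a non-trivial generisation of `x_n` inside the support
  have hζ : IsGenericPoint hZirr.genericPoint Z := hZirr.isGenericPoint_genericPoint hZcl
  have hζx : hZirr.genericPoint ⤳ s.pt := hζ.specializes hxZ
  have hne : hZirr.genericPoint ≠ s.pt := by
    intro he
    apply h.singleton_notMem_componentsIn_of_not_iso hpt hnI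
    have : Z = {s.pt} := by rw [← hζ.def, he, hcl.closure_eq]
    rwa [this] at hZY
  exact one_le_ringKrullDim_quotient_stalkIdeal C hζx hne (componentsIn.subset hZ hζ.mem)


/-- [OURS · L1 W4.2] **THE CYCLE-END CENTRE DICHOTOMY REDUCED TO ITS CURVE CASE (Thm. 3.14 regime).** At a blown-up cycle-end step
`X_n ← X_{n+1}` of a chain under the cycle invariant, with `x_n ∈ V(C)` closed, never isolated, `CharHypothesis X_n x_n` and
`ē_{x_n}(X_n) ≤ 3`: EITHER the centre germ at `x_n` has dimension exactly `1` (a CURVE through `x_n` — the case where a centre-adapted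
CP frame is to be produced, W4.2 D18 (ii)) OR the near fibre of the step over `x_n` is a subsingleton. So `CycleEndCentreDichotomy3` in the
F-61 regime follows from adapted-frame existence along curve centre germs alone. [cite: CossartJannsenSaito2020, Thm. 3.14, Rem. 6.29 (1)] -/
theorem centreGerm_dim_eq_one_or_nearFibre_subsingleton (h314f : Thm314_nearFibre_subsingleton.{u}) {k : Type u} [Field k]
    (hRf : OracleFunctional R) (hRa : OracleAdmissible R) (hν : ν ≠ iterPSum 3 Phi)
    {s s' : MarkedStage.{u}} (h : CycleInv k R 3 ν s) (hst : CanonicalNearStep R 3 ν s s') (hnone : s'.P = none)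
    {f : s'.W ⟶ s.W} (hf : StepProjection R 3 ν s s' f)
    {C : s.W.IdealSheafData} {P' : Option (Pending (blowup C))} (hcs : IsCanonicalStep R 3 ν s.L s.P C P')
    (hmem : s.pt ∈ (C.support : Set s.W)) (hcl : IsClosed ({s.pt} : Set s.W)) (hpt : s.pt ∈ Scheme.hsStratum s.W 3 ν)
    (hnI : ¬ Iso 3 s) (hchar : CharHypothesis s.W s.pt) (hē : s.geomDirDim ≤ 3) :
    ringKrullDim (s.W.presheaf.stalk s.pt ⧸ stalkIdeal C s.pt) = 1 ∨
      {z : s'.W | f.base z = s.pt ∧ z ∈ Scheme.hsStratum s'.W 3 ν}.Subsingleton := by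
  by_cases h2 : ((2 : ℕ) : WithBot ℕ∞) ≤ ringKrullDim (s.W.presheaf.stalk s.pt ⧸ stalkIdeal C s.pt)
  · exact Or.inr (nearFibre_subsingleton_of_two_le_dim_centre h314f hRf hRa hν h hf hcs hmem hchar hpt hē h2)
  · left
    have h1 := one_le_ringKrullDim_centre_of_cycleEnd hRf h hst hnone hcs hmem hcl hpt hnI
    generalize ringKrullDim (s.W.presheaf.stalk s.pt ⧸ stalkIdeal C s.pt) = d at h1 h2 ⊢
    induction d using WithBot.recBotCoe with
    | bot => exact absurd h1 (by simp)
    | coe e =>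
      induction e using ENat.recTopCoe with
      | top => exact absurd (WithBot.coe_le_coe.mpr le_top) h2
      | coe n =>
        have h1' : 1 ≤ n := by exact_mod_cast h1
        have h2' : ¬ 2 ≤ n := fun hn => h2 (WithBot.coe_le_coe.mpr (ENat.coe_le_coe.mpr hn))
        have : n = 1 := by omega
        subst this
        rfl

end Summit.ResolutionOfSingularities.ResolutionOfSingularities.Theorems.SigmaMaxModificationsCorridor3.Moving

end
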